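import Mathlib
import HarnessLib

/-!
# Dimension of a flag of subspaces stable under a transcendental scalar

Topic: `Literature/LinearAlgebra/Filtration`. Two pieces of linear algebra behind the LOWER bounds
for Hilbert functions of prime ideals by generic hyperplane sections (Nesterenko, Mat. Sb. 123
(1984); Chardin, Bull. SMF 117 (1989); Sombra, J. Pure Appl. Algebra 117/118 (1997) §2): for a tower
of fields `F ⊆ K ⊆ Ω` and an element `t ∈ K` transcendental over `F`,

* `sum_finrank_span_le_finrank` — if `W₀ ⊆ W₁ ⊆ ⋯` are finite-dimensional `F`-subspaces of `Ω` with
  `t · W_μ ⊆ W_{μ+1}`, then `∑_{μ ≤ ν} dim_K (K · W_μ) ≤ dim_F W_ν` (the elements `t^{ν−μ} w`, `w`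
  running through NESTED `K`-bases of the `K · W_μ` chosen inside the `W_μ`, are `F`-linearly
  independent: a relation regroups into a `K`-relation among the last basis whose coefficients are
  polynomials in `t` over `F`);
* `min_le_finrank_of_mul_stable` — if `W₀ ⊆ W₁ ⊆ ⋯` are `K`-subspaces of a finite-dimensional
  `K`-subalgebra `A = K[g₁, …, g_n]` of `Ω` with `1 ∈ W₀` and `gᵢ · W_μ ⊆ W_{μ+1}`, then
  `dim_K W_μ ≥ min(μ + 1, dim_K A)` (the flag grows strictly until it is multiplicatively closed,
  and then it is all of `A`).

Applied in `Literature/NumberTheory/Transcendental/NesterenkoHilbertLowerBound.lean` to the spans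
of the monomials in the generic point of a projective curve.

## References

* M. Sombra, *Bounds for the Hilbert function of polynomial ideals and for the degrees in the
  Nullstellensatz*, J. Pure Appl. Algebra 117/118 (1997) 565–599, §2.
* M. Chardin, *Une majoration de la fonction de Hilbert et ses conséquences pour l'interpolation
  algébrique*, Bull. Soc. Math. France 117 (1989) 305–318.
-/

open Module Submodule

namespace Literature.LinearAlgebra.Filtration

section Growth

variable {K Ω : Type*} [Field K] [Field Ω] [Algebra K Ω]

/-- **A multiplicatively generated flag grows until it fills the algebra.** Let `W₀ ≤ W₁ ≤ ⋯` be
`K`-subspaces of `Ω`, all contained in the subalgebra `A = K[gᵢ : i]`, which is finite-dimensional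
over `K`; assume `1 ∈ W₀` and `gᵢ · W_μ ⊆ W_{μ+1}` for all `i, μ`. Then
`min(μ + 1, dim_K A) ≤ dim_K W_μ` for every `μ`. [folklore] -/
theorem min_le_finrank_of_mul_stable {ι : Type*} (g : ι → Ω) (W : ℕ → Submodule K Ω)
    (hmono : ∀ μ, W μ ≤ W (μ + 1)) (h1 : (1 : Ω) ∈ W 0)
    (hg : ∀ μ i, ∀ w ∈ W μ, g i * w ∈ W (μ + 1))
    (hWA : ∀ μ, W μ ≤ Subalgebra.toSubmodule (Algebra.adjoin K (Set.range g)))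
    [FiniteDimensional K (Algebra.adjoin K (Set.range g))] (μ : ℕ) :
    min (μ + 1) (finrank K (Algebra.adjoin K (Set.range g))) ≤ finrank K (W μ) := by
  set A := Algebra.adjoin K (Set.range g) with hA
  haveI hfd : ∀ μ, FiniteDimensional K (W μ) := fun μ =>
    Submodule.finiteDimensional_of_le (hWA μ)
  have hWmono : ∀ μ μ', μ ≤ μ' → W μ ≤ W μ' := by
    intro μ μ' h
    induction h with
    | refl => exact le_rfl
    | step _ ih => exact ih.trans (hmono _)
  -- if the flag stalls at `μ`, it contains `A`
  have hstall : ∀ μ, W μ = W (μ + 1) → Subalgebra.toSubmodule A ≤ W μ := by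
    intro μ heq
    have hmul : ∀ a ∈ A, ∀ w ∈ W μ, a * w ∈ W μ := by
      intro a ha
      refine Algebra.adjoin_induction (fun x hx w hw => ?_) (fun c w hw => ?_)
        (fun x y _ _ hx hy w hw => ?_) (fun x y _ _ hx hy w hw => ?_) ha
      · obtain ⟨i, rfl⟩ := hx
        rw [heq]
        exact hg μ i w hw
      · rw [Algebra.algebraMap_eq_smul_one, smul_mul_assoc, one_mul]
        exact Submodule.smul_mem _ c hw
      · rw [add_mul]
        exact Submodule.add_mem _ (hx w hw) (hy w hw)
      · rw [mul_assoc]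
        exact hx _ (hy w hw)
    intro a ha
    have := hmul a ha 1 (hWmono 0 μ (Nat.zero_le μ) h1)
    rwa [mul_one] at this
  induction μ with
  | zero =>
    have hpos : 0 < finrank K (W 0) := by
      rw [Module.finrank_pos_iff_exists_ne_zero]
      exact ⟨⟨1, h1⟩, fun h => one_ne_zero (congrArg Subtype.val h)⟩
    omega
  | succ μ ih =>
    have hle : finrank K (W μ) ≤ finrank K (W (μ + 1)) := Submodule.finrank_mono (hmono μ)
    by_cases hD : finrank K A ≤ finrank K (W μ)
    · calc min (μ + 1 + 1) (finrank K A) ≤ finrank K A := min_le_right _ _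
        _ ≤ finrank K (W (μ + 1)) := hD.trans hle
    · -- the flag does not stall at `μ`
      have hne : W μ ≠ W (μ + 1) := by
        intro heq
        exact hD (Submodule.finrank_mono (hstall μ heq))
      have hlt : finrank K (W μ) < finrank K (W (μ + 1)) := by
        by_contra hge
        exact hne (Submodule.eq_of_le_of_finrank_eq (hmono μ) (le_antisymm hle (not_lt.mp hge)))
      omega

end Growth

section Flag

variable {F K Ω : Type*} [Field F] [Field K] [Field Ω] [Algebra F K] [Algebra K Ω] [Algebra F Ω]
  [IsScalarTower F K Ω]

/-- Nested `K`-bases adapted to a flag of subsets of `Ω`: if `S₀ ⊆ S₁ ⊆ ⋯ ⊆ S_ν` are subsets each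
contained in a finite-dimensional `F`-subspace, there are finite sets `b₀ ⊆ b₁ ⊆ ⋯ ⊆ b_ν` with
`b_μ ⊆ S_μ`, `b_μ` linearly independent over `K`, and `S_μ ⊆ span_K b_μ`. [folklore] -/
theorem exists_nested_bases (S : ℕ → Set Ω) (hmono : ∀ μ, S μ ⊆ S (μ + 1))
    (hfin : ∀ μ, ∃ V : Submodule F Ω, FiniteDimensional F V ∧ S μ ⊆ V) (ν : ℕ) :
    ∃ b : ℕ → Finset Ω, (∀ μ ≤ ν, ↑(b μ) ⊆ S μ) ∧ (∀ μ ≤ ν, LinearIndepOn K id (b μ : Set Ω)) ∧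
      (∀ μ ≤ ν, S μ ⊆ span K (b μ : Set Ω)) ∧ (∀ μ μ', μ ≤ μ' → μ' ≤ ν → b μ ⊆ b μ') := by
  classical
  -- a `K`-independent subset of a finite-dimensional `F`-space is finite
  have hfinite : ∀ (B : Set Ω) (μ : ℕ), B ⊆ S μ → LinearIndepOn K id B → B.Finite := by
    intro B μ hB hli
    obtain ⟨V, hV, hSV⟩ := hfin μ
    haveI := hV
    have hliF : LinearIndepOn F id B := hli.restrict_scalars' F
    let f : B → V := fun x => ⟨x, hSV (hB x.2)⟩
    have hf : LinearIndependent F f := by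
      refine LinearIndependent.of_comp V.subtype ?_
      exact hliF
    exact Set.finite_coe_iff.mp hf.finite
  induction ν with
  | zero =>
    obtain ⟨B, hBS, -, hSB, hli⟩ :=
      exists_linearIndepOn_id_extension (linearIndepOn_empty K id) (Set.empty_subset (S 0))
    have hBf := hfinite B 0 hBS hli
    refine ⟨fun _ => hBf.toFinset, fun μ hμ => ?_, fun μ hμ => ?_, fun μ hμ => ?_,
      fun μ μ' _ _ => le_rfl⟩
    · obtain rfl : μ = 0 := Nat.le_zero.mp hμ
      simpa using hBS
    · simpa using hli
    · obtain rfl : μ = 0 := Nat.le_zero.mp hμ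
      simpa using hSB
  | succ ν ih =>
    obtain ⟨b, hbS, hbli, hSb, hnest⟩ := ih
    have hsub : (b ν : Set Ω) ⊆ S (ν + 1) := (hbS ν le_rfl).trans (hmono ν)
    obtain ⟨B, hBS, hbB, hSB, hli⟩ := exists_linearIndepOn_id_extension (hbli ν le_rfl) hsub
    have hBf := hfinite B (ν + 1) hBS hli
    refine ⟨fun μ => if μ ≤ ν then b μ else hBf.toFinset, fun μ hμ => ?_, fun μ hμ => ?_,
      fun μ hμ => ?_, fun μ μ' hμμ' hμ' => ?_⟩ <;> dsimp only
    · by_cases h : μ ≤ ν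
      · rw [if_pos h]; exact hbS μ h
      · obtain rfl : μ = ν + 1 := by omega
        rw [if_neg h]; simpa using hBS
    · by_cases h : μ ≤ ν
      · rw [if_pos h]; exact hbli μ h
      · rw [if_neg h]; simpa using hli
    · by_cases h : μ ≤ ν
      · rw [if_pos h]; exact hSb μ h
      · obtain rfl : μ = ν + 1 := by omega
        rw [if_neg h]; simpa using hSB
    · by_cases h' : μ' ≤ ν
      · rw [if_pos (hμμ'.trans h'), if_pos h']
        exact hnest μ μ' hμμ' h'
      · obtain rfl : μ' = ν + 1 := by omega
        by_cases h : μ ≤ ν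
        · rw [if_pos h, if_neg h']
          intro x hx
          have hx' : x ∈ B := hbB (hnest μ ν h le_rfl hx)
          simpa using hx'
        · rw [if_neg h, if_neg h']

/-- **The flag lemma.** Let `F ⊆ K ⊆ Ω` be fields and `t ∈ K` transcendental over `F`. Let
`W₀ ≤ W₁ ≤ ⋯` be `F`-subspaces of `Ω` with `W_ν` finite-dimensional and `t · W_μ ⊆ W_{μ+1}`. Then
`∑_{μ=0}^{ν} dim_K span_K(W_μ) ≤ dim_F W_ν`: for nested `K`-bases `b_μ ⊆ W_μ` of the `span_K W_μ`
the elements `t^{ν−μ} · w` (`μ ≤ ν`, `w ∈ b_μ`) lie in `W_ν` and are linearly independent over `F`,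
because a linear relation regroups as `∑_{w ∈ b_ν} p_w(t) w = 0` with `p_w ∈ F[T]`, whence
`p_w(t) = 0` and `p_w = 0`. [cite: Sombra1997, §2] -/
theorem sum_finrank_span_le_finrank (t : K) (ht : Transcendental F t) (W : ℕ → Submodule F Ω)
    (hmono : ∀ μ, W μ ≤ W (μ + 1)) (htW : ∀ μ, ∀ w ∈ W μ, algebraMap K Ω t * w ∈ W (μ + 1))
    (ν : ℕ) [FiniteDimensional F (W ν)] :
    ∑ μ ∈ Finset.range (ν + 1), finrank K (span K (W μ : Set Ω)) ≤ finrank F (W ν) := by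
  classical
  have hWmono : ∀ μ μ', μ ≤ μ' → W μ ≤ W μ' := by
    intro μ μ' h
    induction h with
    | refl => exact le_rfl
    | step _ ih => exact ih.trans (hmono _)
  haveI hfd : ∀ μ, μ ≤ ν → FiniteDimensional F (W μ) := fun μ hμ =>
    Submodule.finiteDimensional_of_le (hWmono μ ν hμ)
  -- powers of `t` raise the level accordingly
  have htpow : ∀ k μ, ∀ w ∈ W μ, algebraMap K Ω t ^ k * w ∈ W (μ + k) := by
    intro k
    induction k with
    | zero => intro μ w hw; simpa using hw
    | succ k ih =>
      intro μ w hw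
      have := htW (μ + k) _ (ih μ w hw)
      rw [← mul_assoc, ← pow_succ'] at this
      simpa [add_assoc] using this
  -- nested bases (levels above `ν` are irrelevant: truncate the flag at `ν`)
  let S : ℕ → Set Ω := fun μ => (W (min μ ν) : Set Ω)
  obtain ⟨b, hbS, hbli, hSb, hnest⟩ := exists_nested_bases (F := F) (K := K) S
    (fun μ => by
      change (W (min μ ν) : Set Ω) ⊆ W (min (μ + 1) ν)
      exact hWmono _ _ (min_le_min_right ν (Nat.le_succ μ)))
    (fun μ => ⟨W ν, inferInstance, by
      change (W (min μ ν) : Set Ω) ⊆ W ν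
      exact hWmono _ _ (min_le_right μ ν)⟩) ν
  have hSW : ∀ μ ≤ ν, S μ = (W μ : Set Ω) := fun μ hμ => by
    change (W (min μ ν) : Set Ω) = W μ; rw [min_eq_left hμ]
  -- the cardinalities of the bases are the `K`-dimensions
  have hcard : ∀ μ ≤ ν, finrank K (span K (W μ : Set Ω)) = (b μ).card := by
    intro μ hμ
    have hspan : span K (W μ : Set Ω) = span K (b μ : Set Ω) := by
      refine le_antisymm (span_le.mpr ?_) (span_mono ?_)
      · rw [← hSW μ hμ]; exact hSb μ hμ
      · rw [← hSW μ hμ]; exact hbS μ hμ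
    rw [hspan, finrank_span_finset_eq_card (hbli μ hμ)]
  -- the family `t^{ν-μ} w`
  let T : Ω := algebraMap K Ω t
  let f : (Σ _ : ℕ, Ω) → Ω := fun x => T ^ (ν - x.1) * x.2
  let I : Finset (Σ _ : ℕ, Ω) := (Finset.range (ν + 1)).sigma b
  have hfW : ∀ x ∈ I, f x ∈ W ν := by
    rintro ⟨μ, w⟩ hx
    rw [Finset.mem_sigma, Finset.mem_range] at hx
    have hμ : μ ≤ ν := Nat.lt_succ_iff.mp hx.1
    have hw : w ∈ W μ := by
      have := hbS μ hμ hx.2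
      rwa [hSW μ hμ] at this
    have := htpow (ν - μ) μ w hw
    rwa [Nat.add_sub_cancel' hμ] at this
  -- linear independence over `F`
  have hli : LinearIndepOn F f (I : Set (Σ _ : ℕ, Ω)) := by
    rw [linearIndepOn_finset_iff]
    intro c hc
    -- regroup the relation along the last basis `b ν`
    let κ : Ω → K := fun w =>
      ∑ μ ∈ (Finset.range (ν + 1)).filter (fun μ => w ∈ b μ), algebraMap F K (c ⟨μ, w⟩) * t ^ (ν - μ)
    have hregroup : ∑ x ∈ I, c x • f x = ∑ w ∈ b ν, κ w • w := by
      have h1 : ∑ x ∈ I, c x • f x =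
          ∑ μ ∈ Finset.range (ν + 1), ∑ w ∈ b μ, c ⟨μ, w⟩ • (T ^ (ν - μ) * w) :=
        Finset.sum_sigma _ _ _
      have h2 : ∀ μ ∈ Finset.range (ν + 1), ∑ w ∈ b μ, c ⟨μ, w⟩ • (T ^ (ν - μ) * w) =
          ∑ w ∈ b ν, if w ∈ b μ then c ⟨μ, w⟩ • (T ^ (ν - μ) * w) else 0 := by
        intro μ hμ
        have hsub : b μ ⊆ b ν := hnest μ ν (Nat.lt_succ_iff.mp (Finset.mem_range.mp hμ)) le_rfl
        rw [← Finset.sum_filter, Finset.filter_mem_eq_inter, Finset.inter_eq_right.mpr hsub]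
      rw [h1, Finset.sum_congr rfl h2, Finset.sum_comm]
      refine Finset.sum_congr rfl fun w _ => ?_
      rw [Finset.sum_ite, Finset.sum_const_zero, add_zero]
      simp only [κ, Finset.sum_smul]
      refine Finset.sum_congr rfl fun μ _ => ?_
      rw [Algebra.smul_def, Algebra.smul_def, map_mul, map_pow, ← IsScalarTower.algebraMap_apply]
      ring
    rw [hregroup] at hc
    have hκ : ∀ w ∈ b ν, κ w = 0 := (linearIndepOn_finset_iff.mp (hbli ν le_rfl)) κ hc
    -- each `κ w` is the value at `t` of a polynomial over `F`
    rintro ⟨μ₀, w⟩ hx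
    rw [Finset.mem_sigma, Finset.mem_range] at hx
    have hμ₀ : μ₀ ≤ ν := Nat.lt_succ_iff.mp hx.1
    have hwν : w ∈ b ν := hnest μ₀ ν hμ₀ le_rfl hx.2
    let M : Finset ℕ := (Finset.range (ν + 1)).filter (fun μ => w ∈ b μ)
    let p : Polynomial F := ∑ μ ∈ M, Polynomial.monomial (ν - μ) (c ⟨μ, w⟩)
    have hp : Polynomial.aeval t p = 0 := by
      simp only [p, map_sum, Polynomial.aeval_monomial]
      exact hκ w hwν
    have hp0 : p = 0 := by
      by_contra hne
      exact ht ⟨p, hne, hp⟩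
    have hcoeff : p.coeff (ν - μ₀) = c ⟨μ₀, w⟩ := by
      simp only [p, Polynomial.finsetSum_coeff, Polynomial.coeff_monomial]
      rw [Finset.sum_eq_single μ₀]
      · rw [if_pos rfl]
      · intro μ hμ hne
        rw [if_neg]
        intro h
        have hμ' : μ ≤ ν := Nat.lt_succ_iff.mp (Finset.mem_range.mp (Finset.mem_filter.mp hμ).1)
        omega
      · intro hμ₀M
        exact absurd (Finset.mem_filter.mpr ⟨Finset.mem_range.mpr (Nat.lt_succ_iff.mpr hμ₀), hx.2⟩)
          hμ₀M
    rw [← hcoeff, hp0, Polynomial.coeff_zero]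
  -- count
  have hcardI : I.card = ∑ μ ∈ Finset.range (ν + 1), finrank K (span K (W μ : Set Ω)) := by
    rw [Finset.card_sigma]
    exact Finset.sum_congr rfl fun μ hμ =>
      (hcard μ (Nat.lt_succ_iff.mp (Finset.mem_range.mp hμ))).symm
  rw [← hcardI]
  -- an `F`-independent family inside `W ν`
  let g : ↥(I : Set (Σ _ : ℕ, Ω)) → W ν := fun x => ⟨f x.1, hfW x.1 (Finset.mem_coe.mp x.2)⟩
  have hg : LinearIndependent F g := by
    refine LinearIndependent.of_comp (W ν).subtype ?_
    exact hli
  have := hg.fintype_card_le_finrank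
  simpa using this

end Flag

end Literature.LinearAlgebra.Filtration
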